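/- Copyright: the b2b-balaban cell (near-miss cell 7), T⁴-continuum fan-out; row NE7b, leaf lineage `t4-ne7b-formalise-leaf-05`
(gen 52) — decided toys of E-datum E-ne7bleaf05-g52-1 «(d2′) IS ONE LEVEL ON THE ORBIT»; STAGED, NOT FILED under FREEZE (0)
unless the row OWNER asks.  Released under the licence of the surrounding project. -/
import Summits.QuantumFields.BalabanUV.T4Continuum.Support.HistoryReadinessChainScaleOrbit

/-!
# Two decided `S`-orbits in `ℤ¹` for «(d2′) IS ONE LEVEL ON THE ORBIT»: EXACTLY ONE level at memory `13`; THREE levels at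
memory `1` — the memory floor `2 ≤ N` of `HistoryReadinessChainScaleOrbit` is sharp (row NE7b, rider (d2′) of R-OWNER-59-1)

Summits-side support leaf of the T⁴-continuum cell (rung (B)+1 on a FINITE torus only; NOT infinite volume, NOT the mass
gap, NOT the Clay statement; NOT a proof of the spine estimate NE7b — NOT PRINTED, NOT PROVED).  [folklore] decided index
arithmetic on GENUINE `S`-orbits (`HistoryRealise.orbit` = `B16SProfile.Siter` along `ratio`), boxed from above by
`Sop_box_subset` ∕ `Siter_pbox_subset` and from below by the attained corners `B16Absorption.pbox_orbit_subset_Siter`;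
nothing of Bałaban's asserted; zero `sorry`.  (The owner's toy in `HistoryReadinessChainScale` §2 is an arbitrary sequence
`X`, not an orbit; these are orbits, so the flow hypotheses of `…Orbit` §2 are MET, not assumed.)
* §4 `Toy`: `L = 4`, constant exponents (every step gains), memory `13`, `Z = {0, 100}` — two far cubes, the picture of a
  pure join: (i) fails at the formation scale and holds from scale `1` on (orbit boxes of radius `≤ 23`); the tree stops
  first at `13` (`find_stops_eq`), the chain predicate fails at `13` and holds at `14` BY `…Orbit` §3, not by inspection
  (`stopAtC_fourteen`, `find_stopAtC_eq`): on a genuine orbit the rider is REAL and EXACTLY one level; readiness persists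
  (`stops_of_le`) and pendency is the one-index test (`pendingAt_twelve_not_thirteen`).
* §5 `ToyOne`: `L = 2`, exponents `2, 1, 1, 1, 0, 0, …` (no gain at the steps `0` and `3` — DROP-CONTROLLED,
  `dropCtl_σ₁`), memory `1`, `Z = {0, 200}`: the envelopes are decided (`env_vals` `200, 210, 115, 67, 77, 48, 34`;
  `envLo_vals` `0, −10, −15, −18, −28, −24, −22`) and ATTAINED (`corners_mem`), so (i) is LARGE at `0, 1, 2, 4` and small at
  `3, 5, 6` (`condI_table`) — (i) is not one-step monotone, readiness at memory `1` does not persist (`not_stops_four`); the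
  tree stops first at `3`, the printed chain's predicate first at `6 = 3 + 3` (`find_stops_eq`, `find_stopAtC_eq`): at
  memory `1` «tree ready first» by THREE levels `= N + 2` — the transient-loss branch of the refuter's P-ref-g34-1 ∕
  leaf-02 g46's dichotomy («lag one, or lag `≥ N + 2`») is ATTAINED on a genuine orbit, and the floor `2 ≤ N` of
  `…Orbit` §2 (lag `≤ 1`) cannot be dropped.

HONEST SCOPE.  Toys; census NONE; R∕T rows by count UNCHANGED; information-grade.  NE7b NOT PRINTED ∕ NOT PROVED; spine 0∕9.
HONEST DEPENDENCY (cell): continuum YM on T⁴ ⇐ BetaPertH ∧ nine spine estimates (0/9 proved); BetaPertH ⇐ (D1) ∧ (D4) ∧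
CAP+tail; G-an2-4 gates asym, D1 and NE2/3/4.  This file changes none of it.
-/

open Literature.MathematicalPhysics.QuantumFieldTheory.Balaban1983to89
open Literature.MathematicalPhysics.QuantumFieldTheory.Balaban1983to89.B13ScaleTransfer
open Literature.MathematicalPhysics.QuantumFieldTheory.Balaban1983to89.B16SProfile
open Literature.MathematicalPhysics.QuantumFieldTheory.Balaban1983to89.B16MergeGeometry
open Literature.MathematicalPhysics.QuantumFieldTheory.Balaban1983to89.B16MergeGeometry.OneDim (pt pt_apply)
open Literature.MathematicalPhysics.QuantumFieldTheory.Balaban1983to89.B16Absorption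
open Literature.MathematicalPhysics.QuantumFieldTheory.Balaban1983to89.B16MergeHorizon
open Literature.MathematicalPhysics.QuantumFieldTheory.Balaban1983to89.B16StoppingRule
open Summit.QuantumFields.BalabanUV.T4Continuum.HistoryRealise
open Summit.QuantumFields.BalabanUV.T4Continuum.HistoryRealiseMemory
open Summit.QuantumFields.BalabanUV.T4Continuum.HistoryReadinessChainScale
open Summit.QuantumFields.BalabanUV.T4Continuum.HistoryReadinessChainScaleOrbit

namespace Summit.QuantumFields.BalabanUV.T4Continuum.HistoryReadinessChainScaleOrbit

/-! ## §4 Decided `S`-orbit toy in `ℤ¹`: two far cubes, `L = 4`, memory `13` — tree `13`, chain `14` -/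

namespace Toy

/-- constant exponents: every step coarsens by the full factor `L` [folklore] -/
def s₀ : ℕ → ℕ := fun _ => 0

/-- memory `13` at every step [folklore] -/
def R₁₃ : ℕ → ℕ := fun _ => 13

/-- the formation domain: two cubes `0` and `100` of `ℤ¹` — (i)-LARGE (the picture of a pure join of two far
constituents). [folklore] -/
def Z : Finset (Pt 1) := {pt 0, pt 100}

/-- the toy flow is drop-controlled on every horizon [folklore] -/
theorem dropCtl_s₀ (m : ℕ) : DropCtl s₀ m := dropCtl_const 0 m

/-- its ratios are all `4` [folklore] -/
theorem ratio_s₀ (t₀ l : ℕ) : ratio 4 (fun i => s₀ (t₀ + i)) l = 4 := by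
  simp [ratio, qexp, s₀]

/-- the formation domain violates (i) [folklore] -/
theorem not_condI_Z : ¬ CondI 100 Z := by
  rintro ⟨lo, hlo⟩
  have h0 : pt 0 ∈ (↑Z : Set (Pt 1)) := by simp [Z]
  have h1 : pt 100 ∈ (↑Z : Set (Pt 1)) := by simp [Z]
  have a := (hlo h0) 0
  have b := (hlo h1) 0
  simp only [pt] at a b
  push_cast at a b
  omega

/-- … i.e. the orbit at the relative scale `0` does [folklore] -/
theorem not_condI_orbit_zero : ¬ CondI 100 (orbit 4 s₀ 0 Z 0) := by
  simpa using not_condI_Z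

/-- the formation domain lies in the box of radius `50` about `50` [folklore] -/
theorem Z_subset_box : Z ⊆ box (pt 50) 50 := by
  intro y hy
  simp only [Z, Finset.mem_insert, Finset.mem_singleton] at hy
  rw [mem_box]
  intro i
  rcases hy with rfl | rfl <;> simp [pt]

/-- every LATER member of the orbit lies in an index box of radius `23` (`50/4 + 11 = 23`, then `23/4 + 11 = 16 ≤ 23`)
[folklore] -/
theorem orbit_succ_subset_box : ∀ l, ∃ c : Pt 1, orbit 4 s₀ 0 Z (l + 1) ⊆ box c 23
  | 0 => by
    refine ⟨coarse 4 (pt 50), ?_⟩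
    rw [orbit_succ, ratio_s₀, orbit_zero]
    have h := (Sop_mono 4 Z_subset_box).trans (Sop_box_subset (by norm_num : 0 < 4) (pt 50) 50)
    exact h.trans (box_mono _ (by norm_num))
  | l + 1 => by
    obtain ⟨c, hc⟩ := orbit_succ_subset_box l
    refine ⟨coarse 4 c, ?_⟩
    rw [orbit_succ, ratio_s₀]
    have h := (Sop_mono 4 hc).trans (Sop_box_subset (by norm_num : 0 < 4) c 23)
    exact h.trans (box_mono _ (by norm_num))

/-- hence (i) at every relative scale `≥ 1` [folklore] -/
theorem condI_orbit_succ (l : ℕ) : CondI 100 (orbit 4 s₀ 0 Z (l + 1)) := by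
  obtain ⟨c, hc⟩ := orbit_succ_subset_box l
  exact condI_of_subset_box hc (by norm_num)

/-- **THE TREE STOPS AT `13`** (scales `1, …, 13` inspected, all (i)-small; clean steps) [folklore] -/
theorem stops_thirteen : Stops 4 s₀ R₁₃ 0 Z 13 := by
  refine ⟨by norm_num, condI_orbit_succ 12, by simp [R₁₃], fun l h1 h2 => ⟨trivial, ?_⟩⟩
  simp only [R₁₃] at h1
  obtain ⟨l', rfl⟩ : ∃ l', l = l' + 1 := ⟨l - 1, by omega⟩
  exact condI_orbit_succ l'

/-- … and not before (the memory has not elapsed) [folklore] -/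
theorem not_stops_lt (k : ℕ) (hk : k < 13) : ¬ Stops 4 s₀ R₁₃ 0 Z k :=
  fun h => by have := h.le; simp [R₁₃] at this; omega

/-- **THE CHAIN PREDICATE FAILS AT `13`**: its bottom scale `13 − 13 = 0` is the (i)-large formation scale [folklore] -/
theorem not_stopAtC_thirteen : ¬ StopAtC 100 13 (fun _ => True) (orbit 4 s₀ 0 Z) 13 :=
  fun h => not_condI_orbit_zero (by simpa using h.2)

/-- **… AND HOLDS AT `14` — BY §3, not by inspection**: the scale after the tree-stop is (i)-small automatically
[folklore] -/
theorem stopAtC_fourteen : StopAtC 100 13 (fun _ => True) (orbit 4 s₀ 0 Z) 14 :=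
  Stops.stopAtC_succ (by norm_num) dropCtl_s₀ stops_thirteen (by simp [R₁₃])

/-- readiness persists on the toy (§3): the tree is ready at every index `≥ 13` [folklore] -/
theorem stops_of_le {k : ℕ} (hk : 13 ≤ k) : Stops 4 s₀ R₁₃ 0 Z k :=
  Stops.of_le (by norm_num) dropCtl_s₀ stops_thirteen (by simp [R₁₃]) hk

open Classical in
/-- THE LEAST INDICES, decided: the tree's first readiness index is `13` … [folklore] -/
theorem find_stops_eq : Nat.find (⟨13, stops_thirteen⟩ : ∃ k, Stops 4 s₀ R₁₃ 0 Z k) = 13 := by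
  rw [Nat.find_eq_iff]
  exact ⟨stops_thirteen, fun n hn => not_stops_lt n hn⟩

open Classical in
/-- … the printed chain's first index is `14`: «tree ready first» by EXACTLY ONE level on a genuine `S`-orbit.
[folklore] -/
theorem find_stopAtC_eq :
    Nat.find (⟨14, stopAtC_fourteen⟩ : ∃ K, StopAtC 100 13 (fun _ => True) (orbit 4 s₀ 0 Z) K) = 14 := by
  rw [Nat.find_eq_iff]
  refine ⟨stopAtC_fourteen, fun n hn h => ?_⟩
  have h13 := le_of_stopAtC h
  obtain rfl : n = 13 := by omega
  exact not_stopAtC_thirteen h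

/-- pendency on the toy is the one-index test of §3: pending at the cutoff `12`, not at `13` [folklore] -/
theorem pendingAt_twelve_not_thirteen : PendingAt 4 s₀ R₁₃ 0 Z 12 ∧ ¬ PendingAt 4 s₀ R₁₃ 0 Z 13 := by
  have h := fun K => pendingAt_iff_not_stops_last (Z := Z) (K := K) (by norm_num : 2 ≤ 4) dropCtl_s₀
    (show 2 ≤ R₁₃ 0 by simp [R₁₃])
  refine ⟨(h 12).2 ⟨by norm_num, not_stops_lt 12 (by norm_num)⟩, fun hp => ?_⟩
  exact ((h 13).1 hp).2 stops_thirteen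

end Toy

/-! ## §5 The memory floor `N ≥ 2` is SHARP: at memory `1` the rider is THREE levels (decided `S`-orbit in `ℤ¹`,
`L = 2`, a drop-controlled no-gain step right after the tree-stop) -/

namespace ToyOne

/-- exponents `2, 1, 1, 1, 0, 0, …`: the steps `0` and `3` do NOT gain (ratio `1`), every other step gains the full
`L = 2` — one net no-gain step per window of two, as the drop control allows. [folklore] -/
def σ₁ : ℕ → ℕ := fun n => if n = 0 then 2 else if n ≤ 3 then 1 else 0

/-- memory `1` at every step [folklore] -/
def R₁ : ℕ → ℕ := fun _ => 1

/-- the formation domain: the cubes `0` and `200` of `ℤ¹` [folklore] -/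
def Z₂ : Finset (Pt 1) := {pt 0, pt 200}

/-- the orbit's ratio sequence `1, 2, 2, 1, 2, 2, 2, …` [folklore] -/
def q₁ : ℕ → ℕ := ratio 2 (fun i => σ₁ (0 + i))

/-- the toy flow IS drop-controlled on every horizon (so every hypothesis of §2 but the memory floor holds, `L = 2`).
[folklore] -/
theorem dropCtl_σ₁ (m : ℕ) : DropCtl σ₁ m := by
  intro i k hik _
  simp only [σ₁]
  rcases le_total (k - i) 2 with h | h
  · rw [max_eq_right h]
    split_ifs <;> omega
  · rw [max_eq_left h]
    split_ifs <;> omega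

/-- the orbit is the `S`-iterate sequence along `q₁` (definitional) [folklore] -/
theorem orbit_eq : orbit 2 σ₁ 0 Z₂ = fun l => Siter q₁ l Z₂ := rfl

/-- the ratios are positive [folklore] -/
theorem q₁_pos (l : ℕ) : 0 < q₁ l := ratio_pos (by norm_num) _ l

/-- the first ratios, decided: no gain at the steps `0` and `3` [folklore] -/
theorem q₁_vals : q₁ 0 = 1 ∧ q₁ 1 = 2 ∧ q₁ 2 = 2 ∧ q₁ 3 = 1 ∧ q₁ 4 = 2 ∧ q₁ 5 = 2 := by decide

/-- THE UPPER ENVELOPE of the cube `200`: `200, 210, 115, 67, 77, 48, 34` [folklore] -/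
theorem env_vals : env q₁ 200 1 = 210 ∧ env q₁ 200 2 = 115 ∧ env q₁ 200 3 = 67 ∧ env q₁ 200 4 = 77 ∧
    env q₁ 200 5 = 48 ∧ env q₁ 200 6 = 34 := by decide

/-- THE LOWER ENVELOPE of the cube `0`: `0, −10, −15, −18, −28, −24, −22` [folklore] -/
theorem envLo_vals : envLo q₁ 0 1 = -10 ∧ envLo q₁ 0 2 = -15 ∧ envLo q₁ 0 3 = -18 ∧ envLo q₁ 0 4 = -28 ∧
    envLo q₁ 0 5 = -24 ∧ envLo q₁ 0 6 = -22 := by decide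

/-- the orbit at scale `m` lies between the two envelopes … [folklore] -/
theorem Siter_subset (m : ℕ) :
    Siter q₁ m Z₂ ⊆ pbox (fun _ => envLo q₁ 0 m) (fun _ => env q₁ 200 m) := by
  have hZ : Z₂ ⊆ pbox (pt 0) (pt 200) := by
    intro y hy
    simp only [Z₂, Finset.mem_insert, Finset.mem_singleton] at hy
    rw [mem_pbox]
    intro i
    rcases hy with rfl | rfl <;> simp [pt]
  have h := (Siter_subset_Siter q₁ hZ m).trans (Siter_pbox_subset q₁_pos (pt 0) (pt 200) m)
  simpa [pt] using h

/-- … and ATTAINS both (the orbit boxes of the two cubes lie inside it) [folklore] -/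
theorem corners_mem (m : ℕ) :
    (fun _ => envLo q₁ 0 m : Pt 1) ∈ Siter q₁ m Z₂ ∧ (fun _ => env q₁ 200 m : Pt 1) ∈ Siter q₁ m Z₂ := by
  have h0 : pt 0 ∈ Z₂ := by simp [Z₂]
  have h2 : pt 200 ∈ Z₂ := by simp [Z₂]
  constructor
  · refine pbox_orbit_subset_Siter q₁_pos h0 m (mem_pbox.2 fun i => ⟨?_, ?_⟩)
    · simp [pt]
    · simpa [pt] using envLo_le_env q₁_pos (le_refl (0 : ℤ)) m
  · refine pbox_orbit_subset_Siter q₁_pos h2 m (mem_pbox.2 fun i => ⟨?_, ?_⟩)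
    · simpa [pt] using envLo_le_env q₁_pos (le_refl (200 : ℤ)) m
    · simp [pt]

/-- a gap `≤ 99` between the envelopes gives (i) … [folklore] -/
theorem condI_of_gap {m : ℕ} (h : env q₁ 200 m ≤ envLo q₁ 0 m + 99) : CondI 100 (Siter q₁ m Z₂) :=
  fitsIn_of_subset_pbox (Siter_subset m) fun _ => by push_cast; omega

/-- … a gap `≥ 100` refutes it [folklore] -/
theorem not_condI_of_gap {m : ℕ} (h : envLo q₁ 0 m + 100 ≤ env q₁ 200 m) : ¬ CondI 100 (Siter q₁ m Z₂) := by
  rintro ⟨lo, hlo⟩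
  obtain ⟨hl, hh⟩ := corners_mem m
  have a := (hlo (Finset.mem_coe.2 hl)) 0
  have b := (hlo (Finset.mem_coe.2 hh)) 0
  push_cast at a b
  omega

/-- (i) ALONG THE ORBIT, decided: LARGE at the scales `0, 1, 2` and `4`, small at `3, 5, 6` — the no-gain step `3` (ratio
`1`, ten layers each side) re-inflates the extent `86` of scale `3` to `106`. [folklore] -/
theorem condI_table :
    ¬ CondI 100 (Siter q₁ 0 Z₂) ∧ ¬ CondI 100 (Siter q₁ 1 Z₂) ∧ ¬ CondI 100 (Siter q₁ 2 Z₂) ∧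
      CondI 100 (Siter q₁ 3 Z₂) ∧ ¬ CondI 100 (Siter q₁ 4 Z₂) ∧ CondI 100 (Siter q₁ 5 Z₂) ∧
        CondI 100 (Siter q₁ 6 Z₂) := by
  obtain ⟨e1, e2, e3, e4, e5, e6⟩ := env_vals
  obtain ⟨f1, f2, f3, f4, f5, f6⟩ := envLo_vals
  refine ⟨not_condI_of_gap (by simp), not_condI_of_gap (by omega), not_condI_of_gap (by omega),
    condI_of_gap (by omega), not_condI_of_gap (by omega), condI_of_gap (by omega), condI_of_gap (by omega)⟩

/-- at memory `1` the tree's readiness at `k` IS condition (i) at `k ≥ 1` (the window is the one scale `k`) [folklore] -/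
theorem stops_iff {k : ℕ} : Stops 2 σ₁ R₁ 0 Z₂ k ↔ 1 ≤ k ∧ CondI 100 (Siter q₁ k Z₂) := by
  constructor
  · intro h
    exact ⟨h.pos, h.condI⟩
  · rintro ⟨hk, hI⟩
    refine ⟨hk, hI, hk, fun l h1 h2 => ⟨trivial, ?_⟩⟩
    have h1' : k < l + 1 := h1
    obtain rfl : l = k := le_antisymm h2 (by omega)
    exact hI

/-- … and the chain predicate at `K` is readiness at `K` plus (i) at `K − 1` (definitional) [folklore] -/
theorem stopAtC_iff {K : ℕ} :
    StopAtC 100 1 (fun _ => True) (orbit 2 σ₁ 0 Z₂) K ↔ Stops 2 σ₁ R₁ 0 Z₂ K ∧ CondI 100 (Siter q₁ (K - 1) Z₂) :=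
  Iff.rfl

/-- **THE TREE STOPS FIRST AT `3`** … [folklore] -/
theorem stops_three : Stops 2 σ₁ R₁ 0 Z₂ 3 := stops_iff.2 ⟨by norm_num, condI_table.2.2.2.1⟩

/-- … not before … [folklore] -/
theorem not_stops_lt (k : ℕ) (hk : k < 3) : ¬ Stops 2 σ₁ R₁ 0 Z₂ k := by
  intro h
  obtain ⟨hk1, hI⟩ := stops_iff.1 h
  obtain ⟨-, n1, n2, -⟩ := condI_table
  interval_cases k
  · exact n1 hI
  · exact n2 hI

/-- … is NOT ready at `4` (the no-gain step) though ready at `3` — at memory `1` readiness does NOT persist … [folklore] -/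
theorem not_stops_four : ¬ Stops 2 σ₁ R₁ 0 Z₂ 4 := fun h => condI_table.2.2.2.2.1 (stops_iff.1 h).2

/-- **… AND THE PRINTED CHAIN's PREDICATE HOLDS FIRST AT `6`**: it fails at `3` (bottom scale `2` large), at `4` (not
ready), at `5` (bottom scale `4` large). [folklore] -/
theorem stopAtC_six : StopAtC 100 1 (fun _ => True) (orbit 2 σ₁ 0 Z₂) 6 :=
  stopAtC_iff.2 ⟨stops_iff.2 ⟨by norm_num, condI_table.2.2.2.2.2.2⟩, condI_table.2.2.2.2.2.1⟩

/-- no chain-stop before `6` [folklore] -/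
theorem not_stopAtC_lt (K : ℕ) (hK : K < 6) : ¬ StopAtC 100 1 (fun _ => True) (orbit 2 σ₁ 0 Z₂) K := by
  intro h
  obtain ⟨hs, hb⟩ := stopAtC_iff.1 h
  obtain ⟨hk1, hI⟩ := stops_iff.1 hs
  obtain ⟨n0, n1, n2, -, n4, -, -⟩ := condI_table
  interval_cases K
  · exact n1 hI
  · exact n2 hI
  · exact n2 hb
  · exact n4 hI
  · exact n4 hb

open Classical in
/-- THE LEAST INDICES, decided: tree `3` … [folklore] -/
theorem find_stops_eq : Nat.find (⟨3, stops_three⟩ : ∃ k, Stops 2 σ₁ R₁ 0 Z₂ k) = 3 := by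
  rw [Nat.find_eq_iff]
  exact ⟨stops_three, fun n hn => not_stops_lt n hn⟩

open Classical in
/-- … chain `6 = 3 + 3`: at memory `1`, on a drop-controlled `S`-orbit with `L = 2`, «tree ready first» by THREE levels —
the floor `2 ≤ N` of §2 cannot be dropped. [folklore] -/
theorem find_stopAtC_eq :
    Nat.find (⟨6, stopAtC_six⟩ : ∃ K, StopAtC 100 1 (fun _ => True) (orbit 2 σ₁ 0 Z₂) K) = 6 := by
  rw [Nat.find_eq_iff]
  exact ⟨stopAtC_six, fun n hn => not_stopAtC_lt n hn⟩

end ToyOne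

end Summit.QuantumFields.BalabanUV.T4Continuum.HistoryReadinessChainScaleOrbit
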